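import Mathlib
import Summits.Ventures.FusionMHD.Models.TearingFRS1M4Wall
import Summits.Ventures.FusionMHD.Models.TearingFRS1M4Cramer
import Summits.Ventures.FusionMHD.Models.ResistiveSchemas
import Summits.Ventures.FusionMHD.Models.TearingFRS1RegularPoint
import HarnessLib

/-!
# F3.r3 instance «TearingFRS1.M3» ((4,2) mode, `q₀ = 21/20`): THE Δ′ CERTIFICATE — assembly; STABILITY SIDE ON THE PRINTED PROFILE

LADDER-GRIDFUSION rung F3.r3 (models/F3-SCOPING.md §7d, model-6 g5): the `m = 4` copy of `TearingFRS1DeltaPrime.lean`.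
MODEL M₄ (MODELLED; `TearingFRS1M4.lean`, MODEL-VALIDITY MV-7R): marginal outer tearing equation of a straight, zero-β,
single-helicity cylinder, THE PRINTED profile `q = (7/5)(1 + r²/r_a²)` [HamEtAl2013 §4; FRS-1973 `ν = 1`] (row #13's MODEL M), mode `(4, 2)`, `r_s² = (3/7) r_a²`, conducting wall at
`r = 6 r_s`; in `u = r/r_s`: `M4.IsScaledOuterSolution`. THE OBJECT `psi`: on `0 < u ≤ 3/4` the AXIS-REGULAR solution
`a_L⁻¹ u⁴ g(u²)` (`M4.axisL`, `g(0) = 1`); on `3/4 < u < 1` the patch combination `ψ_L(u−1) + b_L ψ_s(u−1)`, which AGREES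
with the axis solution on `(7/10, 7/8)` by uniqueness (`axis_eq_comb`); `ψ(1) = 1`; on `u > 1` the WALL solution
`a_R⁻¹ R(u)` (`M4.wallR`, `R(6) = 0`, values at `5/4` from the kernel Taylor chain `wall6m3`).
CERTIFIED (kernel): `psi_outer_left/right`, `psi_axis(_limit)` (`ψ/u⁴ → a_L⁻¹ ≠ 0`), `psi_wall` (`ψ(6) = 0`);
**`isDeltaPrime_psi : Tearing.IsDeltaPrime psi psi' 1 deltaPrime`** [Miyamoto2007 §9.1 (9.16); Schnack2009 (34.13)];
**`deltaPrime_bounds : -4.39432 < r_s Δ′_{4,2} < -4.39423`** (`-4.3942784881 ± 4.05e-05`);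
**`criterionHolds`** — for the tearing data of MODEL M₄ on the class `C = {(4,2)}` the printed criterion «`Δ′ < 0` on every
resonant mode» (`ResistiveSchemas.tearingSchema`) HOLDS; **`margin_certified` / `hasPositiveMargin`** — the margin
(`MarginSchema.HasMargin`) `−r_s Δ′`: `4.39423` is a margin, `4.39432` is not: A POSITIVE MARGIN ON THE PRINTED PROFILE. READ (three columns): CERTIFIED «MODEL M₄ is on the stability side of the printed zero-β criterion for the
(4,2) tearing mode, certified index r_s Δ′ ∈ [-4.39432, -4.39423], margin ≥ 4.39423» — about MODEL M₄ and
class C, not about any device. VALIDATED (not load-bearing): seat float preview `−4.394` (`teargen/preview_scan.py`). MODELLED: MV-7R; `Δ′ < 0` is the printed constant-ψ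
stability indicator [FurthKilleenRosenbluth1963 §V] and the sufficient side of the GGJ layer threshold (lit-3
`TearingGlasserEffect.not_isGrowthRate_of_nonpos`), not a decay rate. [instance data]
-/

noncomputable section

open Set Filter Literature.Analysis.ODE Literature.MathematicalPhysics.MHD
open Literature.Analysis.ValidatedNumerics.NumericsMP.FB (abs_mul_sub_mul_le)
open scoped Topology

namespace Summit.Ventures.FusionMHD.Models

namespace TearingFRS1

namespace M4

/-! ### Uniqueness of outer solutions inside the plasma column `0 < u < 1` -/

/-- `c(u)` is continuous on `(0, 1)` (no zero of `u`, `u² − 1`, `7 + 3u²` there). [instance data] -/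
theorem continuousOn_modelC_unit : ContinuousOn M4.modelC (Ioo 0 1) := by
  have h : ∀ u ∈ Ioo (0 : ℝ) 1, (7 + 3 * u ^ 2) ^ 2 * (u ^ 2 - 1) ≠ 0 := by
    intro u hu
    have h1 : u ^ 2 - 1 < 0 := by nlinarith [hu.1, hu.2]
    have h7 : (0 : ℝ) < (7 + 3 * u ^ 2) ^ 2 := by positivity
    exact mul_ne_zero h7.ne' h1.ne
  unfold M4.modelC
  refine ContinuousOn.add ?_ ?_
  · exact ContinuousOn.div continuousOn_const (by fun_prop) fun u hu => by
      have : (0 : ℝ) < u := hu.1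
      positivity
  · exact ContinuousOn.div continuousOn_const (by fun_prop) h

/-- UNIQUENESS inside the plasma: two outer solutions of MODEL M on `(a, b) ⊆ (0, 1)` with the same data at one point
agree on `(a, b)` (Grönwall; `Literature.Analysis.ODE.eqOn_of_solution_Ioo`). [cite: Hartman2002, Ch. IV Lemma 1.1] -/
theorem outer_eqOn_unit {L L' R R' : ℝ → ℝ} {a b t₀ : ℝ} (ha : 0 ≤ a) (hb : b ≤ 1) (ht₀ : t₀ ∈ Ioo a b)
    (hL : M4.IsScaledOuterSolution L L' (Ioo a b)) (hR : M4.IsScaledOuterSolution R R' (Ioo a b))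
    (h0 : L t₀ = R t₀) (h1 : L' t₀ = R' t₀) : EqOn L R (Ioo a b) ∧ EqOn L' R' (Ioo a b) := by
  have hsub : Ioo a b ⊆ Ioo 0 1 := fun u hu => ⟨lt_of_le_of_lt ha hu.1, lt_of_lt_of_le hu.2 hb⟩
  have hp : ContinuousOn (fun u : ℝ => -1 / u) (Ioo a b) :=
    ContinuousOn.div continuousOn_const continuousOn_id fun u hu => ne_of_gt (hsub hu).1
  have hq : ContinuousOn M4.modelC (Ioo a b) := continuousOn_modelC_unit.mono hsub
  refine eqOn_of_solution_Ioo (𝕜 := ℝ) hp hq ht₀ (fun u hu => ⟨(hL u hu).1, ((hL u hu).2).congr_deriv ?_⟩)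
    (fun u hu => ⟨(hR u hu).1, ((hR u hu).2).congr_deriv ?_⟩) h0 h1
  · rw [M4.modelC]; ring
  · rw [M4.modelC]; ring

/-! ### The patch combinations `ψ_L + b ψ_s` are outer solutions near the surface -/

/-- `comb b u = ψ_L(u − 1) + b ψ_s(u − 1)`: a combination of the certified Frobenius pair at the surface, read in `u`.
[instance data] -/
def comb (b u : ℝ) : ℝ :=
  ((scalarLogSol pc M4.qc 1 (14 / 5) Real.log) (u - 1)).1 + b * ((scalarSmallSol pc M4.qc) (u - 1)).1

/-- Its derivative function `ψ_L′(u − 1) + b ψ_s′(u − 1)`. [instance data] -/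
def comb' (b u : ℝ) : ℝ :=
  ((scalarLogSol pc M4.qc 1 (14 / 5) Real.log) (u - 1)).2 + b * ((scalarSmallSol pc M4.qc) (u - 1)).2

/-- On any set of radii with `0 < |u − 1| < 3/10` the combination solves MODEL M₄. [instance data] -/
theorem comb_outer (b : ℝ) {s : Set ℝ} (hs : ∀ u ∈ s, |u - 1| < 3 / 10 ∧ u ≠ 1) :
    M4.IsScaledOuterSolution (M4.comb b) (M4.comb' b) s := by
  intro u hu
  obtain ⟨hx, hx0⟩ := hs u hu
  have hx0' : u - 1 ≠ 0 := sub_ne_zero.2 hx0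
  obtain ⟨h1, h2⟩ := patch_combination (δ := 3 / 10) (by norm_num) smallPatchOn_three_tenths logPatchOn_three_tenths b hx hx0'
  refine ⟨?_, ?_⟩
  · show HasDerivAt (fun v => comb b v) (comb' b u) u
    unfold comb comb'
    exact h1.comp_sub_const u 1
  · show HasDerivAt (fun v => comb' b v)
      (-(comb' b u) / u + (16 / u ^ 2 + 560 / ((7 + 3 * u ^ 2) ^ 2 * (u ^ 2 - 1))) * comb b u) u
    have e : (1 : ℝ) + (u - 1) = u := by ring
    have h3 := h2.comp_sub_const u 1
    unfold comb comb'
    refine h3.congr_deriv ?_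
    simp only [modelP, modelQ, e]
    ring

/-- The left half-patch `(7/10, 1)`. [instance data] -/
theorem comb_outer_left (b : ℝ) : M4.IsScaledOuterSolution (M4.comb b) (M4.comb' b) (Ioo (7 / 10) 1) :=
  comb_outer b fun u hu => ⟨by rw [abs_lt]; constructor <;> linarith [hu.1, hu.2], hu.2.ne⟩

/-- The right half-patch `(1, 13/10)`. [instance data] -/
theorem comb_outer_right (b : ℝ) : M4.IsScaledOuterSolution (M4.comb b) (M4.comb' b) (Ioo 1 (13 / 10)) :=
  comb_outer b fun u hu => ⟨by rw [abs_lt]; constructor <;> linarith [hu.1, hu.2], hu.1.ne'⟩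

/-! ### Non-vanishing Wronskians at the two matching points (from the certified enclosures) -/

/-- Patch Wronskian at `x = −1/4` (`m = 4`): `ψ_L ψ_s′ − ψ_L′ ψ_s ≈ 4/3 ≠ 0` (Abel: `= 1/(1 + x)`). [instance data] -/
theorem patchW_neg_ne_zero :
    (scalarLogSol pc M4.qc 1 (14 / 5) Real.log (-1 / 4 : ℝ)).1 * (scalarSmallSol pc M4.qc (-1 / 4 : ℝ)).2
      - (scalarLogSol pc M4.qc 1 (14 / 5) Real.log (-1 / 4 : ℝ)).2 * (scalarSmallSol pc M4.qc (-1 / 4 : ℝ)).1 ≠ 0 := by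
  have h := abs_sub_sub_le' (abs_mul_sub_mul_le l1_neg small_snd_neg) (abs_mul_sub_mul_le l2_neg small_fst_neg)
  intro h0; rw [h0] at h; norm_num [abs_of_neg, abs_of_pos] at h

/-- Patch Wronskian at `x = +1/4` (`m = 4`): `≈ 4/5 ≠ 0`. [instance data] -/
theorem patchW_pos_ne_zero :
    (scalarLogSol pc M4.qc 1 (14 / 5) Real.log (1 / 4 : ℝ)).1 * (scalarSmallSol pc M4.qc (1 / 4 : ℝ)).2
      - (scalarLogSol pc M4.qc 1 (14 / 5) Real.log (1 / 4 : ℝ)).2 * (scalarSmallSol pc M4.qc (1 / 4 : ℝ)).1 ≠ 0 := by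
  have h := abs_sub_sub_le' (abs_mul_sub_mul_le l1_pos small_snd_pos) (abs_mul_sub_mul_le l2_pos small_fst_pos)
  intro h0; rw [h0] at h; norm_num [abs_of_neg, abs_of_pos] at h

/-- Wronskian of the `m = 4` axis solution with `ψ_s` at `u = 3/4`: `≠ 0` (`bL_den`). [instance data] -/
theorem denL_ne_zero :
    M4.axisL (3 / 4) * (scalarSmallSol pc M4.qc (-1 / 4 : ℝ)).2 - M4.axisL' (3 / 4) * (scalarSmallSol pc M4.qc (-1 / 4 : ℝ)).1 ≠ 0 := by
  have h := bL_den
  intro h0; rw [h0] at h; norm_num [abs_of_neg, abs_of_pos] at h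

/-- Wronskian of the `m = 4` wall solution with `ψ_s` at `u = 5/4`: `≠ 0` (from `wallR_box`). [instance data] -/
theorem denR_ne_zero :
    M4.wallR (5 / 4) * (scalarSmallSol pc M4.qc (1 / 4 : ℝ)).2 - M4.wallR' (5 / 4) * (scalarSmallSol pc M4.qc (1 / 4 : ℝ)).1 ≠ 0 := by
  have h := abs_sub_sub_le' (abs_mul_sub_mul_le wallR_box.1 small_snd_pos) (abs_mul_sub_mul_le wallR_box.2 small_fst_pos)
  intro h0; rw [h0] at h; norm_num [abs_of_neg, abs_of_pos] at h

/-! ### Cramer scales, the index, and the glued outer solution -/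

/-- The Cramer SCALE of the axis solution at `u = 3/4`: `a_L = W(L, ψ_s)/W(ψ_L, ψ_s)` at `x = −1/4`. [instance data] -/
def aL : ℝ :=
  (M4.axisL (3 / 4) * (scalarSmallSol pc M4.qc (-1 / 4 : ℝ)).2 - M4.axisL' (3 / 4) * (scalarSmallSol pc M4.qc (-1 / 4 : ℝ)).1)
    / ((scalarLogSol pc M4.qc 1 (14 / 5) Real.log (-1 / 4 : ℝ)).1 * (scalarSmallSol pc M4.qc (-1 / 4 : ℝ)).2
        - (scalarLogSol pc M4.qc 1 (14 / 5) Real.log (-1 / 4 : ℝ)).2 * (scalarSmallSol pc M4.qc (-1 / 4 : ℝ)).1)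

/-- The Cramer SCALE of the wall solution at `u = 5/4`: `a_R = W(R, ψ_s)/W(ψ_L, ψ_s)` at `x = +1/4`. [instance data] -/
def aR : ℝ :=
  (M4.wallR (5 / 4) * (scalarSmallSol pc M4.qc (1 / 4 : ℝ)).2 - M4.wallR' (5 / 4) * (scalarSmallSol pc M4.qc (1 / 4 : ℝ)).1)
    / ((scalarLogSol pc M4.qc 1 (14 / 5) Real.log (1 / 4 : ℝ)).1 * (scalarSmallSol pc M4.qc (1 / 4 : ℝ)).2
        - (scalarLogSol pc M4.qc 1 (14 / 5) Real.log (1 / 4 : ℝ)).2 * (scalarSmallSol pc M4.qc (1 / 4 : ℝ)).1)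

/-- `a_L ≠ 0`: the normalised left function is a NON-ZERO multiple of the axis solution. [instance data] -/
theorem aL_ne_zero : M4.aL ≠ 0 := div_ne_zero denL_ne_zero patchW_neg_ne_zero

/-- `a_R ≠ 0`: the normalised right function is a NON-ZERO multiple of the wall solution. [instance data] -/
theorem aR_ne_zero : M4.aR ≠ 0 := div_ne_zero denR_ne_zero patchW_pos_ne_zero

/-- **`r_s Δ′_{2,1}` OF MODEL M**: the difference `b_R − b_L` of the Cramer coefficients of THE wall solution and THE
axis solution against the Frobenius pair (`TearingFRS1Cramer.lean`). That this number IS the printed tearing index of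
the glued outer solution is `isDeltaPrime_psi`. [instance data] -/
def deltaPrime : ℝ := M4.bR (M4.wallR (5 / 4)) (M4.wallR' (5 / 4)) - M4.bL

/-- The matching identities of the axis solution at `u = 3/4` (Cramer): `a_L⁻¹ (L, L′)(3/4) = (ψ_L, ψ_L′)(−1/4) + b_L (ψ_s, ψ_s′)(−1/4)`.
[instance data] -/
theorem axis_match :
    M4.aL⁻¹ * M4.axisL (3 / 4) = (scalarLogSol pc M4.qc 1 (14 / 5) Real.log (-1 / 4 : ℝ)).1 + bL * (scalarSmallSol pc M4.qc (-1 / 4 : ℝ)).1 ∧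
      M4.aL⁻¹ * M4.axisL' (3 / 4) = (scalarLogSol pc M4.qc 1 (14 / 5) Real.log (-1 / 4 : ℝ)).2 + bL * (scalarSmallSol pc M4.qc (-1 / 4 : ℝ)).2 := by
  have h := cramer_normalise (l₁ := (scalarLogSol pc M4.qc 1 (14 / 5) Real.log (-1 / 4 : ℝ)).1)
    (l₂ := (scalarLogSol pc M4.qc 1 (14 / 5) Real.log (-1 / 4 : ℝ)).2) denL_ne_zero
  rw [inv_mul_eq_div, inv_mul_eq_div]
  exact h

/-- The matching identities of the wall solution at `u = 5/4` (Cramer). [instance data] -/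
theorem wall_match :
    M4.aR⁻¹ * M4.wallR (5 / 4) = (scalarLogSol pc M4.qc 1 (14 / 5) Real.log (1 / 4 : ℝ)).1
        + bR (wallR (5 / 4)) (wallR' (5 / 4)) * (scalarSmallSol pc M4.qc (1 / 4 : ℝ)).1 ∧
      M4.aR⁻¹ * M4.wallR' (5 / 4) = (scalarLogSol pc M4.qc 1 (14 / 5) Real.log (1 / 4 : ℝ)).2
        + bR (wallR (5 / 4)) (wallR' (5 / 4)) * (scalarSmallSol pc M4.qc (1 / 4 : ℝ)).2 := by
  have h := cramer_normalise (l₁ := (scalarLogSol pc M4.qc 1 (14 / 5) Real.log (1 / 4 : ℝ)).1)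
    (l₂ := (scalarLogSol pc M4.qc 1 (14 / 5) Real.log (1 / 4 : ℝ)).2) denR_ne_zero
  rw [inv_mul_eq_div, inv_mul_eq_div]
  exact h

/-- **THE GLUED OUTER SOLUTION `ψ` OF MODEL M**: axis-regular solution (normalised) up to the left matching point,
patch combination `ψ_L + b_L ψ_s` on `(3/4, 1)`, `ψ(1) = 1`, wall solution (normalised) beyond the surface.
[instance data] -/
def psi (u : ℝ) : ℝ :=
  if u ≤ 3 / 4 then M4.aL⁻¹ * M4.axisL u else if u < 1 then comb bL u else if u = 1 then 1 else aR⁻¹ * wallR u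

/-- The derivative function of `ψ` off the surface (its value AT `u = 1` is immaterial: `ψ′` diverges logarithmically
there and only the symmetric jump enters `Δ′`). [instance data] -/
def psi' (u : ℝ) : ℝ :=
  if u ≤ 3 / 4 then M4.aL⁻¹ * M4.axisL' u else if u < 1 then comb' bL u else aR⁻¹ * wallR' u

/-- IDENTIFICATION ON THE OVERLAP: on `(7/10, 7/8)` the normalised axis solution IS the patch combination
`ψ_L + b_L ψ_s` (equal data at `u = 3/4` by `axis_match`; uniqueness `outer_eqOn_unit`). [instance data] -/
theorem axis_eq_comb :
    EqOn (fun u => M4.aL⁻¹ * M4.axisL u) (M4.comb M4.bL) (Ioo (7 / 10) (7 / 8)) ∧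
      EqOn (fun u => M4.aL⁻¹ * M4.axisL' u) (M4.comb' M4.bL) (Ioo (7 / 10) (7 / 8)) := by
  refine outer_eqOn_unit (t₀ := 3 / 4) (by norm_num) (by norm_num) ⟨by norm_num, by norm_num⟩
    ((axisL_outer.mono ?_).smul aL⁻¹) (comb_outer bL ?_) ?_ ?_
  · intro u hu; exact ⟨by linarith [hu.1], hu.2⟩
  · intro u hu; exact ⟨by rw [abs_lt]; constructor <;> linarith [hu.1, hu.2], ne_of_lt (by linarith [hu.2])⟩
  · show aL⁻¹ * axisL (3 / 4) = comb bL (3 / 4)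
    rw [comb, show (3 / 4 : ℝ) - 1 = -1 / 4 by norm_num]; exact axis_match.1
  · show aL⁻¹ * axisL' (3 / 4) = comb' bL (3 / 4)
    rw [comb', show (3 / 4 : ℝ) - 1 = -1 / 4 by norm_num]; exact axis_match.2

/-- `ψ = ψ_L + b_L ψ_s` (with derivatives) on the whole left half-patch `(1/2, 1)`. [instance data] -/
theorem psi_eq_comb_left : ∀ u ∈ Ioo (7 / 10 : ℝ) 1, M4.psi u = M4.comb M4.bL u ∧ M4.psi' u = M4.comb' M4.bL u := by
  intro u hu
  by_cases h34 : u ≤ 3 / 4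
  · have hI : u ∈ Ioo (7 / 10 : ℝ) (7 / 8) := ⟨hu.1, by linarith⟩
    exact ⟨(if_pos h34).trans (axis_eq_comb.1 hI), (if_pos h34).trans (axis_eq_comb.2 hI)⟩
  · exact ⟨(if_neg h34).trans (if_pos hu.2), (if_neg h34).trans (if_pos hu.2)⟩

/-- `ψ = a_R⁻¹ R` (with derivatives) beyond the surface. [instance data] -/
theorem psi_eq_wall_right : ∀ u ∈ Ioi (1 : ℝ), M4.psi u = M4.aR⁻¹ * M4.wallR u ∧ M4.psi' u = M4.aR⁻¹ * M4.wallR' u := by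
  intro u hu
  have hu' : (1 : ℝ) < u := hu
  have h1 : ¬ u ≤ 3 / 4 := not_le.2 (by linarith)
  have h2 : ¬ u < 1 := not_lt.2 hu'.le
  have h3 : u ≠ 1 := hu'.ne'
  exact ⟨(if_neg h1).trans ((if_neg h2).trans (if_neg h3)), (if_neg h1).trans (if_neg h2)⟩

/-- `ψ(1) = 1` (`= η(0)`, the regular part of `ψ_L` at the surface). [instance data] -/
theorem psi_one : M4.psi 1 = 1 := by norm_num [M4.psi]

/-- THE WALL CONDITION: `ψ(6) = 0`. [instance data] -/
theorem psi_wall : M4.psi 6 = 0 := by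
  have h := (psi_eq_wall_right 6 (by norm_num)).1
  rw [h, wall_spec.1, mul_zero]

/-- REGULARITY AT THE AXIS: on `(0, 3/4]`, `ψ(u) = a_L⁻¹ u⁴ g(u²)` with `g` the certified axis Frobenius series,
`g(0) = 1` (`ψ ∝ r^m`, `m = 4`, as printed). [instance data] -/
theorem psi_axis : (∀ u ∈ Ioc (0 : ℝ) (3 / 4), M4.psi u = M4.aL⁻¹ * (u ^ 4 * (M4.axisG (u ^ 2)).1)) ∧ (M4.axisG 0).1 = 1 := by
  refine ⟨fun u hu => ?_, by rw [axisG_zero]⟩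
  exact (if_pos hu.2).trans (by rw [M4.axisL])

/-- `ψ(u)/u⁴ → a_L⁻¹ (≠ 0)` as `u → 0⁺`. [instance data] -/
theorem psi_axis_limit : Tendsto (fun u => M4.psi u / u ^ 4) (𝓝[>] 0) (𝓝 M4.aL⁻¹) := by
  -- continuity of the axis series at `t = 0`
  have hG : ContinuousAt (fun t : ℝ => (axisG t).1) 0 := by
    have hd := hasDerivAt_tsum_pow_smul_zero
      (w := fun n => frobeniusCoeff M4.MA (fun _ => 0) M4.RA ((1 : ℝ), (-4 / 7 : ℝ)) n) axis_bound (by norm_num)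
    have e : (fun y : ℝ => ∑' n, y ^ n • frobeniusCoeff M4.MA (fun _ => 0) M4.RA ((1 : ℝ), (-4 / 7 : ℝ)) n) = M4.axisG := by
      funext y; rw [M4.axisG, frobeniusSol]
    rw [e] at hd
    exact (ContinuousLinearMap.fst ℝ ℝ ℝ).continuous.continuousAt.comp hd.continuousAt
  have h1 : Tendsto (fun u : ℝ => u ^ 2) (𝓝 0) (𝓝 0) := by
    simpa using ((continuous_pow 2 (M := ℝ)).tendsto 0)
  have hc : Tendsto (fun u : ℝ => M4.aL⁻¹ * (M4.axisG (u ^ 2)).1) (𝓝 0) (𝓝 (M4.aL⁻¹ * (M4.axisG 0).1)) :=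
    (hG.tendsto.comp h1).const_mul M4.aL⁻¹
  rw [axisG_zero] at hc
  dsimp only at hc
  rw [mul_one] at hc
  refine (tendsto_nhdsWithin_of_tendsto_nhds hc).congr' ?_
  filter_upwards [Ioo_mem_nhdsGT (show (0 : ℝ) < 3 / 4 by norm_num)] with u hu
  have hu0 : u ^ 4 ≠ 0 := pow_ne_zero 4 hu.1.ne'
  rw [psi_axis.1 u ⟨hu.1, hu.2.le⟩, mul_comm (u ^ 4) ((M4.axisG (u ^ 2)).1), ← mul_assoc, mul_div_assoc,
    div_self hu0, mul_one]

/-- **`ψ` SOLVES MODEL M INSIDE THE PLASMA, `0 < u < 1`.** [instance data] -/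
theorem psi_outer_left : M4.IsScaledOuterSolution M4.psi M4.psi' (Ioo 0 1) := by
  intro u hu
  by_cases h : u < 3 / 4
  · -- near `u`, `ψ` is the normalised axis solution
    have hev : ∀ᶠ v in 𝓝 u, M4.psi v = M4.aL⁻¹ * M4.axisL v := by
      filter_upwards [Iio_mem_nhds h] with v hv using if_pos (le_of_lt hv)
    have hev' : ∀ᶠ v in 𝓝 u, M4.psi' v = M4.aL⁻¹ * M4.axisL' v := by
      filter_upwards [Iio_mem_nhds h] with v hv using if_pos (le_of_lt hv)
    obtain ⟨h1, h2⟩ := (axisL_outer.smul M4.aL⁻¹) u ⟨hu.1, by linarith⟩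
    have e1 : M4.psi u = M4.aL⁻¹ * M4.axisL u := if_pos h.le
    have e2 : M4.psi' u = M4.aL⁻¹ * M4.axisL' u := if_pos h.le
    refine ⟨?_, ?_⟩
    · rw [e2]; exact h1.congr_of_eventuallyEq hev
    · rw [e1, e2]; exact h2.congr_of_eventuallyEq hev'
  · -- near `u`, `ψ` is the patch combination (identification below `3/4`)
    have hu' : u ∈ Ioo (7 / 10 : ℝ) 1 := ⟨by linarith [not_lt.1 h], hu.2⟩
    have hev : ∀ᶠ v in 𝓝 u, M4.psi v = M4.comb M4.bL v := by
      filter_upwards [Ioo_mem_nhds hu'.1 hu'.2] with v hv using (psi_eq_comb_left v hv).1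
    have hev' : ∀ᶠ v in 𝓝 u, M4.psi' v = M4.comb' M4.bL v := by
      filter_upwards [Ioo_mem_nhds hu'.1 hu'.2] with v hv using (psi_eq_comb_left v hv).2
    obtain ⟨h1, h2⟩ := comb_outer_left bL u hu'
    obtain ⟨e1, e2⟩ := psi_eq_comb_left u hu'
    refine ⟨?_, ?_⟩
    · rw [e2]; exact h1.congr_of_eventuallyEq hev
    · rw [e1, e2]; exact h2.congr_of_eventuallyEq hev'

/-- **`ψ` SOLVES MODEL M BETWEEN THE SURFACE AND THE WALL (indeed on `u > 1`).** [instance data] -/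
theorem psi_outer_right : M4.IsScaledOuterSolution M4.psi M4.psi' (Ioi 1) := by
  intro u hu
  have hu' : (1 : ℝ) < u := hu
  have hev : ∀ᶠ v in 𝓝 u, M4.psi v = M4.aR⁻¹ * M4.wallR v := by
    filter_upwards [Ioi_mem_nhds hu'] with v hv using (psi_eq_wall_right v hv).1
  have hev' : ∀ᶠ v in 𝓝 u, M4.psi' v = M4.aR⁻¹ * M4.wallR' v := by
    filter_upwards [Ioi_mem_nhds hu'] with v hv using (psi_eq_wall_right v hv).2
  obtain ⟨h1, h2⟩ := (wall_spec.2.2.smul M4.aR⁻¹) u hu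
  obtain ⟨e1, e2⟩ := psi_eq_wall_right u hu
  refine ⟨?_, ?_⟩
  · rw [e2]; exact h1.congr_of_eventuallyEq hev
  · rw [e1, e2]; exact h2.congr_of_eventuallyEq hev'

/-! ### The certificate -/

/-- **THE PRINTED TEARING INDEX OF `ψ` EXISTS AND EQUALS `deltaPrime`** (`m = 4`): `Tearing.IsDeltaPrime ψ ψ′ 1 (b_R − b_L)`
[Miyamoto2007 §9.1 (9.16); Schnack2009 (34.13)], by `isDeltaPrime_of_matching` (`δ = 2/5`, `x₀ = 1/4`, patch facts
`smallPatchOn_two_fifths` / `logPatchOn_two_fifths`). [instance data] -/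
theorem isDeltaPrime_psi : Tearing.IsDeltaPrime M4.psi M4.psi' 1 M4.deltaPrime := by
  have hL : M4.IsScaledOuterSolution (M4.comb M4.bL) (M4.comb' M4.bL) (Ioo (1 - 3 / 10) 1) := by
    rw [show (1 : ℝ) - 3 / 10 = 7 / 10 by norm_num]; exact comb_outer_left M4.bL
  have hR : M4.IsScaledOuterSolution (fun u => M4.aR⁻¹ * M4.wallR u) (fun u => M4.aR⁻¹ * M4.wallR' u) (Ioo 1 (1 + 3 / 10)) :=
    (wall_spec.2.2.mono fun u hu => hu.1).smul M4.aR⁻¹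
  have hLm : M4.comb M4.bL (1 - 1 / 4) = (scalarLogSol pc M4.qc 1 (14 / 5) Real.log (-(1 / 4 : ℝ))).1
      + M4.bL * (scalarSmallSol pc M4.qc (-(1 / 4 : ℝ))).1 := by
    rw [M4.comb, show (1 : ℝ) - 1 / 4 - 1 = -(1 / 4) by norm_num]
  have hLm' : M4.comb' M4.bL (1 - 1 / 4) = (scalarLogSol pc M4.qc 1 (14 / 5) Real.log (-(1 / 4 : ℝ))).2
      + M4.bL * (scalarSmallSol pc M4.qc (-(1 / 4 : ℝ))).2 := by
    rw [M4.comb', show (1 : ℝ) - 1 / 4 - 1 = -(1 / 4) by norm_num]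
  have hRm : M4.aR⁻¹ * M4.wallR (1 + 1 / 4) = (scalarLogSol pc M4.qc 1 (14 / 5) Real.log (1 / 4 : ℝ)).1
      + M4.bR (M4.wallR (5 / 4)) (M4.wallR' (5 / 4)) * (scalarSmallSol pc M4.qc (1 / 4 : ℝ)).1 := by
    rw [show (1 : ℝ) + 1 / 4 = 5 / 4 by norm_num]; exact wall_match.1
  have hRm' : M4.aR⁻¹ * M4.wallR' (1 + 1 / 4) = (scalarLogSol pc M4.qc 1 (14 / 5) Real.log (1 / 4 : ℝ)).2
      + M4.bR (M4.wallR (5 / 4)) (M4.wallR' (5 / 4)) * (scalarSmallSol pc M4.qc (1 / 4 : ℝ)).2 := by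
    rw [show (1 : ℝ) + 1 / 4 = 5 / 4 by norm_num]; exact wall_match.2
  have hψl : ∀ u ∈ Ioo (1 - 3 / 10 : ℝ) 1, M4.psi u = M4.comb M4.bL u ∧ M4.psi' u = M4.comb' M4.bL u := by
    intro u hu
    exact psi_eq_comb_left u ⟨by linarith [hu.1], hu.2⟩
  have hψr : ∀ u ∈ Ioo (1 : ℝ) (1 + 3 / 10), M4.psi u = M4.aR⁻¹ * M4.wallR u ∧ M4.psi' u = M4.aR⁻¹ * M4.wallR' u :=
    fun u hu => psi_eq_wall_right u hu.1
  exact isDeltaPrime_of_matching (by norm_num) (by norm_num) (by norm_num) smallPatchOn_three_tenths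
    logPatchOn_three_tenths hL hR hLm hLm' hRm hRm' hψl psi_one hψr

/-- **`r_s Δ′_{4,2} = -4.3942784881 ± 4.05e-05 < 0`** (`bR_sub_bL_of_box` on the chain box `wallR_box`;
VALIDATED float preview `−4.394`). [instance data] -/
theorem deltaPrime_val : |M4.deltaPrime - ((-54928481101 / 12500000000 : ℝ))| ≤ (81007 / 2000000000 : ℝ) ∧ M4.deltaPrime < 0 :=
  bR_sub_bL_of_box wallR_box.1 wallR_box.2

/-- **`-4.39432 < r_s Δ′_{4,2} < -4.39423`.** [instance data] -/
theorem deltaPrime_bounds : ((-54929 / 12500 : ℝ)) < M4.deltaPrime ∧ M4.deltaPrime < ((-439423 / 100000 : ℝ)) := by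
  have h := abs_le.1 deltaPrime_val.1
  constructor <;> linarith [h.1, h.2]

/-- `Δ′` of `ψ` is NEGATIVE, in the printed sense (any `Δ` with `IsDeltaPrime ψ ψ′ 1 Δ` equals `deltaPrime`). [instance data] -/
theorem deltaPrime_neg_of_isDeltaPrime {Δ : ℝ} (h : Tearing.IsDeltaPrime M4.psi M4.psi' 1 Δ) : Δ < 0 := by
  rw [h.unique isDeltaPrime_psi]; exact deltaPrime_val.2

/-! ### The schema verdict: MODEL M₄ against the class `C = {(4,2)}` — THE STABLE SIDE, A POSITIVE MARGIN -/

open ResistiveSchemas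

/-- THE TEARING DATA OF MODEL M₄ ON THE CLASS `C = {(4,2)}` (single mode; the index of the axis-regular, wall-vanishing
outer solution `ψ`, certified above). MODELLED: other resonant modes of the profile are NOT in this class. [instance data] -/
def tearingData42 : TearingData where
  resonant := {((4 : ℤ), (2 : ℤ))}
  deltaPrime := fun _ => M4.deltaPrime

/-- **THE PRINTED CRITERION HOLDS FOR MODEL M₄ ON `C = {(4,2)}`**: `Δ′_{4,2} < 0` — MODEL M₄ is on the STABILITY side of
the zero-β constant-ψ tearing criterion [Schnack2009 (34.15); Miyamoto2007 (9.24); FurthKilleenRosenbluth1963 §V] for the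
`(4,2)` mode. A statement about MODEL M₄ and class C only (sufficient for linear tearing stability in every printed
layer model of models/F3-SCOPING.md §3 W2; not a growth rate, not about any device). [instance data] -/
theorem criterionHolds : tearingSchema.CriterionHolds M4.tearingData42 := by
  rw [tearingSchema_criterionHolds_iff]
  intro i hi
  exact deltaPrime_val.2

/-- Margins of MODEL M₄ against `C`: `m` is a margin iff `m ≤ −r_s Δ′_{4,2}`. [instance data] -/
theorem hasMargin_iff (m : ℝ) : tearingSchema.HasMargin M4.tearingData42 m ↔ m ≤ -M4.deltaPrime := by
  rw [tearingSchema_hasMargin_iff]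
  simp only [M4.tearingData42, Set.mem_singleton_iff, forall_eq]
  exact le_neg

/-- **THE CERTIFIED POSITIVE MARGIN** («margin `m` for MODEL M₄ against class `C`», `MarginSchema.HasMargin`):
`m = 4.39423` IS a margin and `m = 4.39432` is NOT — the margin is POSITIVE.
[instance data] -/
theorem margin_certified :
    tearingSchema.HasMargin M4.tearingData42 ((439423 / 100000 : ℝ)) ∧
      ¬ tearingSchema.HasMargin M4.tearingData42 ((54929 / 12500 : ℝ)) := by
  rw [hasMargin_iff, hasMargin_iff]
  refine ⟨by linarith [deltaPrime_bounds.2], fun h => ?_⟩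
  linarith [deltaPrime_bounds.1]

/-- **MODEL M₄ HAS A POSITIVE TEARING MARGIN AGAINST `C = {(4,2)}`** (`MarginSchema.HasPositiveMargin`, witness
`m = 4.39423`). [instance data] -/
theorem hasPositiveMargin : tearingSchema.HasPositiveMargin M4.tearingData42 :=
  ⟨(439423 / 100000 : ℝ), by norm_num, margin_certified.1⟩

end M4

end TearingFRS1

end Summit.Ventures.FusionMHD.Models

end
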